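import Literature.Geometry.Kaehler.ComplexTorusEquivariantEndomorphismAlgebraCommutantCenterCMFields
import Literature.Geometry.Kaehler.ComplexTorusEquivariantEndomorphismAlgebraCommutantHodgeGroupClassSums
import Literature.Geometry.Kaehler.ComplexTorusEquivariantEndomorphismAlgebraCommutantCMTypesCount
import Literature.RepresentationTheory.FiniteGroups.GroupAlgebraCenter
import Mathlib.LinearAlgebra.LinearIndependent.BaseChange
import HarnessLib

/-!
# The dimension of the centre of `End_ℚ^G(X)` in the equality case: `dim_ℚ Z(End_ℚ^G(X))` is the number of
# irreducible characters of `G` occurring in `H₁(X,ℂ)`, and the real span of the Hodge group has dimension at most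
# that number (Isaacs Thm. 2.12–2.13, Ch. 3 p. 36; James–Liebeck Prop. 12.22; Lange–Rodríguez §2.9.1;
# Dolgachev–Zarhin Remark 2.17; Lange 2023 §7.2 Props. 7.2.5–7.2.6)

Layer `Literature/Geometry/Kaehler`, namespace `Literature.Geometry.Kaehler.ComplexTorus`; lane `lit-hodgefound` (Track 2
foundations library), Layer A2, row «A2-26(eb)» (self-proposed 2026-08-27, prover seat `lit-hodgefound-p10`, generation 25,
FILE 5; sequel to FILE 4 = g25-#4 `…CommutantCenterCMFields` (the centre coordinates `ω_χ`, the bridge `ρ̄(x) ⊗ ℂ = ρ_ℂ(ι x)`),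
to g24's `…CommutantHodgeGroupClassSums` (`Hg(X)(ℝ) ⊆ span_ℝ{A_g}`, "here only the upper bound `≤ k(G)`"), g23's
`…CommutantCenter` (`Z(End_ℚ^G(X)) = ρ̄(Z(ℚ[G]))`) and p38's `RepresentationTheory/FiniteGroups/GroupAlgebraCenter` (the
class sums are a basis of `Z(k[G])`)).  Everything here is **proved**; no definition, no named fact.

## The mathematics

`X = E/Φ(ℤ^ι)`, `G` finite acting by `ρ`, `ρ̄ : ℚ[G] → End_ℚ(X)`, `ρ_ℂ : ℂ[G] → M_ι(ℂ)`, `P_χ = ρ_ℂ(e_χ)`; a character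
`χ ∈ Irr(G)` OCCURS (in `H₁(X,ℂ)`) when `P_χ ≠ 0`.
* (§2) The occurring `P_χ` are a `ℂ`-basis of `ρ_ℂ(Z(ℂ[G]))` — they span by `ρ_ℂ(z) = Σ_χ ω_χ(z) P_χ` (Isaacs Ch. 3:
  "`𝔛(z) = ω_χ(z) I`") and are independent as non-zero orthogonal idempotents (Thm. 2.13: "`e_i e_j = δ_{ij} e_i`");
  hence `dim_ℂ ρ_ℂ(Z(ℂ[G])) = #{χ occurring}`.
* (§1, §3) The class sums `C_c` are a basis of `Z(ℚ[G])` and of `Z(ℂ[G])` (James–Liebeck 12.22), `ρ_ℂ(C_c) = ρ̄(C_c) ⊗ ℂ`,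
  and the `ℂ`-span of a family of RATIONAL matrices has the `ℚ`-dimension of their `ℚ`-span (extension of scalars does
  not change the rank); hence `dim_ℚ ρ̄(Z(ℚ[G])) = #{χ occurring}` and likewise over `ℝ`.
* (§4) In the equality case `End_ℚ^G(X) = End_{ℚ[G]}(H₁(X,ℚ))` the centre of `End_ℚ^G(X)` IS `ρ̄(Z(ℚ[G]))` (g23), so
  **`dim_ℚ Z(End_ℚ^G(X)) = #{χ ∈ Irr(G) occurring}`** — with g25-#4: `= Σ` over the occurring Galois classes of
  `[ℚ(χ):ℚ]`, every `ℚ(χ)` a CM field.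
* (§5) The Hodge group: `Hg(X)(ℝ) ⊆ span_ℝ{A_g}` (g24) with `A_g = ρ̄(Σ_h hgh⁻¹) ⊗ ℝ ∈ ρ̄(Z(ℚ[G])) ⊗ ℝ`, so
  **`dim_ℝ span_ℝ Hg(X)(ℝ) ≤ #{χ occurring} (≤ k(G))`** — the sharp form of g24's a-priori bound (Lange 2023 Prop.
  7.2.6: `Hg(X)` is commutative iff `X` has CM; here `Hg(X)(ℝ)` lies in the commutative algebra `Z(End_ℚ^G(X)) ⊗ ℝ`).

## Sources, verbatim

I. M. Isaacs, *Character Theory of Finite Groups* (1976): Thm. 2.12 ("`e_i = χ_i(1)|G|⁻¹ Σ χ_i(g⁻¹) g`"), Thm. 2.13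
(proof: "`e_i e_j = δ_{ij} e_i`", "`1 = Σ e_i`"), Thm. 2.4 ("`Z(ℂ[G])` has as a basis the class sums"), Ch. 3 p. 36
("`𝔛(z) = ω_χ(z) I` for `z ∈ Z(ℂ[G])`") (held p0024–p0025, p0020, p0040).  G. James, M. Liebeck, *Representations and
Characters of Groups* (2001), Prop. 12.22 ("the class sums `C̄_1, …, C̄_l` form a basis of `Z(ℂG)`", held p0072).
H. Lange, R. E. Rodríguez (2022), §2.9.1 ("`ℚ[G] = Q_1 × ⋯ × Q_r`", p0043).  I. Dolgachev, Yu. G. Zarhin (2024), §2.2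
Remark 2.17, (2.18).  H. Lange, *Abelian Varieties over the Complex Numbers* (2023), §7.2.2 Prop. 7.2.5, §7.2.3 Prop. 7.2.6.

## What is proved

* §1 (private, generic linear algebra) the `K`-span of a finite family of `k`-rational vectors / matrices has the
  `k`-dimension of their `k`-span (`k ⊆ K` fields; Mathlib `linearIndependent_algebraMap_comp_iff`).
* §2 `complexGroupAlgebraRep_charIdempotent_mem_map_center`, `linearIndependent_complexGroupAlgebraRep_charIdempotent`,
  `map_center_complexGroupAlgebraRep_eq_span`, **`finrank_map_center_complexGroupAlgebraRep_eq_card`**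
  (`dim_ℂ ρ_ℂ(Z(ℂ[G])) = #{χ occurring}`).
* §3 `ratToComplex_classSum`, `map_center_complexGroupAlgebraRep_eq_span_classSum`, `map_center_groupAlgebraRep_eq_span_classSum`,
  `complexGroupAlgebraRep_classSum_eq_map`, **`finrank_map_center_groupAlgebraRep_eq_card`** (`dim_ℚ ρ̄(Z(ℚ[G])) = #{χ occurring}`),
  `finrank_span_range_sum_conj_le_card_occurring` (`dim_ℝ span_ℝ{A_g} ≤ #{χ occurring}`).
* §4 (equality case) **`finrank_center_endAlgRatG_eq_card`** (`dim_ℚ Z(End_ℚ^G(X)) = #{χ occurring}`),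
  `finrank_center_endAlgRatG_le_card_irrChars`, `filter_ne_zero_eq_occChars` / `finrank_center_endAlgRatG_eq_card_occChars`
  (g24's `occChars`), `even_finrank_center_endAlgRatG` (the occurring `χ` come in conjugate pairs `χ ≠ χ̄`).
* §5 (equality case) **`finrank_span_image_hodgeGroup_le_card_occurring`**, `finrank_span_image_hodgeGroup_le_finrank_center`.

## References

* [Isaacs1976] I. M. Isaacs, *Character Theory of Finite Groups*, Academic Press (1976), Thms. 2.4, 2.12, 2.13, Ch. 3 p. 36.
* [JamesLiebeck2001] G. James, M. Liebeck, *Representations and Characters of Groups*, 2nd ed., CUP (2001), §12 Prop. 12.22.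
* [LangeRodriguez2022] H. Lange, R. E. Rodríguez, *Decomposition of Jacobians by Prym Varieties*, LNM 2310 (2022), §2.9.1.
* [DolgachevZarhin2024] I. Dolgachev, Yu. G. Zarhin, *Endomorphisms of Complex Abelian Varieties* (2024), §2.2 Remark 2.17, (2.18).
* [Lange2023AbelianVarietiesComplex] H. Lange, *Abelian Varieties over the Complex Numbers* (2023), §7.2.2 Prop. 7.2.5, §7.2.3 Prop. 7.2.6.
-/

noncomputable section

open Module Function Submodule
open scoped Matrix ComplexConjugate

namespace Literature.Geometry.Kaehler

namespace ComplexTorus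

open HopfAlgebra NumberField Literature.RepresentationTheory.FiniteGroups

universe u

/-! ### §1 Extension of scalars does not change the dimension of a span of rational vectors (private) -/

section BaseChange

/-- The `K`-span of the images `algebraMap k K ∘ v a` of a finite family of vectors `v a ∈ k^κ` has `K`-dimension
equal to the `k`-dimension of the `k`-span of the `v a` (a maximal `k`-independent subfamily stays `K`-independent,
Mathlib `linearIndependent_algebraMap_comp_iff`, and still spans). [folklore] -/
private theorem finrank_span_range_algebraMap_comp_v {k K : Type*} [Field k] [Field K] [Algebra k K]
    {α κ : Type*} [Finite α] [Finite κ] (v : α → κ → k) :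
    finrank K (span K (Set.range fun a ↦ algebraMap k K ∘ v a)) = finrank k (span k (Set.range v)) := by
  classical
  obtain ⟨b, hbsub, hbspan, hbli⟩ := exists_linearIndependent k (Set.range v)
  haveI : Fintype b := ((Set.finite_range v).subset hbsub).fintype
  -- the `k`-side: `dim span(range v) = |b|`
  have hk : finrank k (span k (Set.range v)) = Fintype.card b := by
    rw [← hbspan, ← finrank_span_eq_card hbli, Subtype.range_coe]
  -- the `K`-side: the family `algebraMap ∘ x`, `x ∈ b`, is `K`-independent and spans
  let φ : (κ → k) →ₗ[k] (κ → K) := (Algebra.linearMap k K).compLeft κ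
  have hφ : ∀ x : κ → k, φ x = algebraMap k K ∘ x := fun x ↦ rfl
  have hliK : LinearIndependent K (fun x : b ↦ algebraMap k K ∘ (x : κ → k)) :=
    linearIndependent_algebraMap_comp_iff.mpr hbli
  have hspanK : span K (Set.range fun x : b ↦ algebraMap k K ∘ (x : κ → k)) =
      span K (Set.range fun a ↦ algebraMap k K ∘ v a) := by
    apply le_antisymm
    · refine span_mono ?_
      rintro _ ⟨x, rfl⟩
      obtain ⟨a, ha⟩ := hbsub x.2
      exact ⟨a, show algebraMap k K ∘ v a = algebraMap k K ∘ (x : κ → k) by rw [ha]⟩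
    · refine span_le.mpr ?_
      rintro _ ⟨a, rfl⟩
      have hmem : v a ∈ span k b := by rw [hbspan]; exact subset_span (Set.mem_range_self a)
      have h1 : φ (v a) ∈ (span k b).map φ := mem_map_of_mem hmem
      rw [map_span] at h1
      have h2 : (φ '' b) = Set.range fun x : b ↦ algebraMap k K ∘ (x : κ → k) := by
        ext y
        simp only [Set.mem_image, Set.mem_range, hφ, Subtype.exists, exists_prop]
      rw [h2, hφ] at h1
      exact span_le_restrictScalars k K _ h1
  rw [← hspanK, finrank_span_eq_card hliK, hk]

/-- Matrix form: the `K`-span of a finite family of `k`-rational matrices `(A a) ⊗ K` has the `k`-dimension of their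
`k`-span. [folklore] -/
private theorem finrank_span_range_map_algebraMap_m {k K : Type*} [Field k] [Field K] [Algebra k K]
    {α m n : Type*} [Finite α] [Fintype m] [Fintype n] (A : α → Matrix m n k) :
    finrank K (span K (Set.range fun a ↦ (A a).map (algebraMap k K))) = finrank k (span k (Set.range A)) := by
  -- uncurry matrices to vectors indexed by `m × n`
  let ek : Matrix m n k ≃ₗ[k] (m × n → k) := (Matrix.ofLinearEquiv k).symm ≪≫ₗ (LinearEquiv.curry k k m n).symm
  let eK : Matrix m n K ≃ₗ[K] (m × n → K) := (Matrix.ofLinearEquiv K).symm ≪≫ₗ (LinearEquiv.curry K K m n).symm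
  have hcomm : ∀ a, eK ((A a).map (algebraMap k K)) = algebraMap k K ∘ ek (A a) := fun a ↦ by
    funext p
    rfl
  have h1 : finrank k (span k (Set.range A)) = finrank k (span k (Set.range fun a ↦ ek (A a))) := by
    rw [← LinearEquiv.finrank_map_eq ek (span k (Set.range A)), map_span, ← Set.range_comp]
    rfl
  have h2 : finrank K (span K (Set.range fun a ↦ (A a).map (algebraMap k K))) =
      finrank K (span K (Set.range fun a ↦ eK ((A a).map (algebraMap k K)))) := by
    rw [← LinearEquiv.finrank_map_eq eK (span K _), map_span, ← Set.range_comp]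
    rfl
  have h3 : (fun a ↦ eK ((A a).map (algebraMap k K))) = fun a ↦ algebraMap k K ∘ ek (A a) := funext hcomm
  rw [h1, h2, h3]
  exact finrank_span_range_algebraMap_comp_v (fun a ↦ ek (A a))

end BaseChange

variable {ι : Type u} [Fintype ι] [DecidableEq ι] {E : Type*} [NormedAddCommGroup E] [NormedSpace ℂ E]
  {Φ : (ι → ℝ) ≃L[ℝ] E} {G : Type} [Group G] [Fintype G] (ρ : G →* endAlgRat Φ)

/-! ### §2 The occurring projectors `P_χ` are a basis of `ρ_ℂ(Z(ℂ[G]))` -/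

section ComplexCentre

/-- `P_χ = ρ_ℂ(e_χ) ∈ ρ_ℂ(Z(ℂ[G]))` (`e_χ` is central). [cite: Isaacs1976, Thm. 2.12 and Cor. 2.7 (`e_i ∈ Z(ℂ[G])`), p0024, p0021] -/
theorem complexGroupAlgebraRep_charIdempotent_mem_map_center {χ : G → ℂ} (hχ : IsIrrChar G χ) :
    complexGroupAlgebraRep ρ (charIdempotent χ) ∈
      (Subalgebra.center ℂ (MonoidAlgebra ℂ G)).map (complexGroupAlgebraRep ρ) :=
  Subalgebra.mem_map.mpr ⟨charIdempotent χ, hχ.charIdempotent_mem_center, rfl⟩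

/-- **The non-zero `P_χ` are linearly independent** (orthogonal idempotents: multiply a relation `Σ c_χ P_χ = 0` by
`P_ψ` — "`e_i e_j = δ_{ij} e_i`"). [cite: Isaacs1976, Thm. 2.13 (proof), p0025] [cite: LangeRodriguez2022, §2.8 after (2.23), p0040] -/
theorem linearIndependent_complexGroupAlgebraRep_charIdempotent :
    LinearIndependent ℂ (fun χ : {χ : G → ℂ // IsIrrChar G χ ∧ complexGroupAlgebraRep ρ (charIdempotent χ) ≠ 0} ↦
      complexGroupAlgebraRep ρ (charIdempotent χ.1)) := by
  classical
  haveI : Fintype {χ : G → ℂ // IsIrrChar G χ ∧ complexGroupAlgebraRep ρ (charIdempotent χ) ≠ 0} :=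
    ((irrChars_finite_holds G).subset (fun χ (h : IsIrrChar G χ ∧ _) ↦ h.1)).fintype
  rw [Fintype.linearIndependent_iff]
  intro c hc ψ
  have h := congrArg (fun M ↦ M * complexGroupAlgebraRep ρ (charIdempotent ψ.1)) hc
  simp only [Finset.sum_mul, zero_mul, smul_mul_assoc] at h
  rw [Finset.sum_eq_single ψ] at h
  · rw [← map_mul, (isIdempotentElem_charIdempotent ψ.2.1).eq] at h
    exact (smul_eq_zero.1 h).resolve_right ψ.2.2
  · intro χ _ hne
    rw [← map_mul, charIdempotent_mul_charIdempotent_of_ne χ.2.1 ψ.2.1 (fun heq ↦ hne (Subtype.ext heq)), map_zero,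
      smul_zero]
  · intro h'
    exact absurd (Finset.mem_univ ψ) h'

/-- **`ρ_ℂ(Z(ℂ[G])) = span_ℂ {P_χ : χ occurring}`** (`ρ_ℂ(z) = Σ_χ ω_χ(z) P_χ` for central `z`, and each `P_χ = ρ_ℂ(e_χ)`
with `e_χ` central). [cite: Isaacs1976, Ch. 3 p. 36 and Thm. 2.12, p0040, p0024] [cite: LangeRodriguez2022, §2.8 (2.21)–(2.22), p0040] -/
theorem map_center_complexGroupAlgebraRep_eq_span :
    Subalgebra.toSubmodule ((Subalgebra.center ℂ (MonoidAlgebra ℂ G)).map (complexGroupAlgebraRep ρ)) =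
      span ℂ (Set.range fun χ : {χ : G → ℂ // IsIrrChar G χ ∧ complexGroupAlgebraRep ρ (charIdempotent χ) ≠ 0} ↦
        complexGroupAlgebraRep ρ (charIdempotent χ.1)) := by
  classical
  apply le_antisymm
  · rintro M hM
    obtain ⟨z, hz, rfl⟩ := Subalgebra.mem_map.mp hM
    rw [complexGroupAlgebraRep_eq_sum_centralChar_smul ρ hz]
    refine sum_mem fun χ hχ ↦ ?_
    by_cases hP : complexGroupAlgebraRep ρ (charIdempotent χ) = 0
    · rw [hP, smul_zero]; exact zero_mem _
    · exact smul_mem _ _ (subset_span ⟨⟨χ, (irrChars_finite_holds G).mem_toFinset.1 hχ, hP⟩, rfl⟩)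
  · refine span_le.mpr ?_
    rintro _ ⟨χ, rfl⟩
    exact complexGroupAlgebraRep_charIdempotent_mem_map_center ρ χ.2.1

/-- **`dim_ℂ ρ_ℂ(Z(ℂ[G])) = #{χ ∈ Irr(G) : P_χ ≠ 0}`, the number of irreducible characters occurring in `H₁(X,ℂ)`.**
[cite: Isaacs1976, Thm. 2.13 and Ch. 3 p. 36, p0025, p0040] [cite: LangeRodriguez2022, §2.9.1 ("`ℚ[G] = Q_1 × ⋯ × Q_r`"), p0043] -/
theorem finrank_map_center_complexGroupAlgebraRep_eq_card :
    finrank ℂ (Subalgebra.toSubmodule ((Subalgebra.center ℂ (MonoidAlgebra ℂ G)).map (complexGroupAlgebraRep ρ))) =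
      ((irrChars_finite_holds G).toFinset.filter fun χ ↦ complexGroupAlgebraRep ρ (charIdempotent χ) ≠ 0).card := by
  classical
  haveI : Fintype {χ : G → ℂ // IsIrrChar G χ ∧ complexGroupAlgebraRep ρ (charIdempotent χ) ≠ 0} :=
    ((irrChars_finite_holds G).subset (fun χ (h : IsIrrChar G χ ∧ _) ↦ h.1)).fintype
  rw [map_center_complexGroupAlgebraRep_eq_span, finrank_span_eq_card (linearIndependent_complexGroupAlgebraRep_charIdempotent ρ),
    ← Fintype.card_coe]
  refine Fintype.card_congr (Equiv.subtypeEquiv (Equiv.refl _) fun χ ↦ ?_)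
  rw [Finset.mem_filter, Set.Finite.mem_toFinset]
  rfl

end ComplexCentre

/-! ### §3 `dim_ℚ ρ̄(Z(ℚ[G])) = dim_ℂ ρ_ℂ(Z(ℂ[G]))`: class-sum bases and extension of scalars -/

section RationalCentre

omit [Fintype G] in
/-- `ι(q • g) = q • g` for `ι : ℚ[G] → ℂ[G]`. [cite: LangeRodriguez2022, §2.8 (2.21) (`ℚ[G] ⊂ ℂ[G]`), p0040] -/
private theorem ratToComplex_smul_of_d (q : ℚ) (g : G) :
    MonoidAlgebra.mapRingHom G (algebraMap ℚ ℂ) (q • MonoidAlgebra.of ℚ G g) = (q : ℂ) • MonoidAlgebra.of ℂ G g := by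
  rw [MonoidAlgebra.of_apply, MonoidAlgebra.of_apply, MonoidAlgebra.smul_single', mul_one,
    MonoidAlgebra.mapRingHom_single, eq_ratCast, MonoidAlgebra.smul_single', mul_one]

/-- **`ι(C_c) = C_c`**: the change of scalars maps the rational class sum of a conjugacy class to the complex one.
[cite: JamesLiebeck2001, §12 Prop. 12.22 (class sums), held chunk p0072] -/
theorem ratToComplex_classSum (c : ConjClasses G) :
    MonoidAlgebra.mapRingHom G (algebraMap ℚ ℂ)
        (∑ g : G, (ConjClasses.carrier c).indicator (1 : G → ℚ) g • MonoidAlgebra.of ℚ G g) =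
      ∑ g : G, (ConjClasses.carrier c).indicator (1 : G → ℂ) g • MonoidAlgebra.of ℂ G g := by
  classical
  rw [map_sum]
  refine Finset.sum_congr rfl fun g _ ↦ ?_
  rw [ratToComplex_smul_of_d]
  congr 1
  simp only [Set.indicator_apply, Pi.one_apply]
  split_ifs <;> simp

/-- Over any field `k`, **`ρ_k(Z(k[G]))` is the `k`-span of the images of the class sums** (the class sums are a basis of
`Z(k[G])`) — complex form: `ρ_ℂ(Z(ℂ[G])) = span_ℂ {ρ_ℂ(C_c)}`. [cite: JamesLiebeck2001, §12 Prop. 12.22, held chunk p0072]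
[cite: Isaacs1976, Thm. 2.4, p0020] -/
theorem map_center_complexGroupAlgebraRep_eq_span_classSum :
    Subalgebra.toSubmodule ((Subalgebra.center ℂ (MonoidAlgebra ℂ G)).map (complexGroupAlgebraRep ρ)) =
      span ℂ (Set.range fun c : ConjClasses G ↦ complexGroupAlgebraRep ρ
        (∑ g : G, (ConjClasses.carrier c).indicator (1 : G → ℂ) g • MonoidAlgebra.of ℂ G g)) := by
  classical
  obtain ⟨b, hb⟩ := exists_basis_center_eq_classSum (k := ℂ) (G := G)
  have hcenter : Subalgebra.toSubmodule (Subalgebra.center ℂ (MonoidAlgebra ℂ G)) =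
      span ℂ (Set.range fun c : ConjClasses G ↦ ((b c : Subalgebra.center ℂ (MonoidAlgebra ℂ G)) : MonoidAlgebra ℂ G)) := by
    have h := congrArg (Submodule.map (Subalgebra.center ℂ (MonoidAlgebra ℂ G)).val.toLinearMap) b.span_eq
    rw [map_span, Submodule.map_top, ← Set.range_comp] at h
    have hset : (Set.range fun c : ConjClasses G ↦ ((b c : Subalgebra.center ℂ (MonoidAlgebra ℂ G)) : MonoidAlgebra ℂ G)) =
        Set.range (⇑(Subalgebra.center ℂ (MonoidAlgebra ℂ G)).val.toLinearMap ∘ ⇑b) := rfl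
    rw [hset, h]
    ext x
    constructor
    · intro hx
      exact ⟨⟨x, hx⟩, rfl⟩
    · rintro ⟨y, rfl⟩
      exact y.2
  rw [Subalgebra.map_toSubmodule, hcenter, map_span, ← Set.range_comp]
  refine congrArg (fun f : ConjClasses G → Matrix ι ι ℂ ↦ span ℂ (Set.range f)) (funext fun c ↦ ?_)
  rw [Function.comp_apply, AlgHom.toLinearMap_apply, hb]

/-- Rational form: **`ρ̄(Z(ℚ[G])) = span_ℚ {ρ̄(C_c)}`** (as rational matrices). [cite: JamesLiebeck2001, §12 Prop. 12.22, held chunk p0072]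
[cite: LangeRodriguez2022, §2.9.1 (2.26)–(2.28), p0042–p0043] -/
theorem map_center_groupAlgebraRep_eq_span_classSum :
    (Subalgebra.toSubmodule (Subalgebra.center ℚ (MonoidAlgebra ℚ G))).map
        ((endAlgRat Φ).val.toLinearMap ∘ₗ (groupAlgebraRep ρ).toLinearMap) =
      span ℚ (Set.range fun c : ConjClasses G ↦ ((groupAlgebraRep ρ
        (∑ g : G, (ConjClasses.carrier c).indicator (1 : G → ℚ) g • MonoidAlgebra.of ℚ G g) : endAlgRat Φ) :
          Matrix ι ι ℚ)) := by
  classical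
  obtain ⟨b, hb⟩ := exists_basis_center_eq_classSum (k := ℚ) (G := G)
  have hcenter : Subalgebra.toSubmodule (Subalgebra.center ℚ (MonoidAlgebra ℚ G)) =
      span ℚ (Set.range fun c : ConjClasses G ↦ ((b c : Subalgebra.center ℚ (MonoidAlgebra ℚ G)) : MonoidAlgebra ℚ G)) := by
    have h := congrArg (Submodule.map (Subalgebra.center ℚ (MonoidAlgebra ℚ G)).val.toLinearMap) b.span_eq
    rw [map_span, Submodule.map_top, ← Set.range_comp] at h
    have hset : (Set.range fun c : ConjClasses G ↦ ((b c : Subalgebra.center ℚ (MonoidAlgebra ℚ G)) : MonoidAlgebra ℚ G)) =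
        Set.range (⇑(Subalgebra.center ℚ (MonoidAlgebra ℚ G)).val.toLinearMap ∘ ⇑b) := rfl
    rw [hset, h]
    ext x
    constructor
    · intro hx
      exact ⟨⟨x, hx⟩, rfl⟩
    · rintro ⟨y, rfl⟩
      exact y.2
  rw [hcenter, map_span, ← Set.range_comp]
  refine congrArg (fun f : ConjClasses G → Matrix ι ι ℚ ↦ span ℚ (Set.range f)) (funext fun c ↦ ?_)
  rw [Function.comp_apply, LinearMap.coe_comp, Function.comp_apply, AlgHom.toLinearMap_apply, AlgHom.toLinearMap_apply,
    hb]
  rfl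

/-- `ρ_ℂ(C_c) = ρ̄(C_c) ⊗ ℂ` for every conjugacy class. [cite: LangeRodriguez2022, §2.9.1 (2.26) and §2.2 (2.6), p0042, p0029] -/
theorem complexGroupAlgebraRep_classSum_eq_map (c : ConjClasses G) :
    complexGroupAlgebraRep ρ (∑ g : G, (ConjClasses.carrier c).indicator (1 : G → ℂ) g • MonoidAlgebra.of ℂ G g) =
      ((groupAlgebraRep ρ (∑ g : G, (ConjClasses.carrier c).indicator (1 : G → ℚ) g • MonoidAlgebra.of ℚ G g) :
        endAlgRat Φ) : Matrix ι ι ℚ).map (Rat.cast : ℚ → ℂ) := by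
  rw [map_ratCast_coe_groupAlgebraRep, ratToComplex_classSum]

/-- **`dim_ℚ ρ̄(Z(ℚ[G])) = #{χ ∈ Irr(G) : P_χ ≠ 0}`**: the rational centre image has the dimension of the complex one
(both are spanned by the images of the class sums, `ρ_ℂ(C_c) = ρ̄(C_c) ⊗ ℂ`, and extension of scalars preserves the
dimension of a span of rational matrices). [cite: JamesLiebeck2001, §12 Prop. 12.22, held chunk p0072]
[cite: Isaacs1976, Thm. 2.13 and Ch. 3 p. 36, p0025, p0040] [cite: LangeRodriguez2022, §2.9.1, p0043] -/
theorem finrank_map_center_groupAlgebraRep_eq_card :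
    finrank ℚ ((Subalgebra.toSubmodule (Subalgebra.center ℚ (MonoidAlgebra ℚ G))).map
        ((endAlgRat Φ).val.toLinearMap ∘ₗ (groupAlgebraRep ρ).toLinearMap)) =
      ((irrChars_finite_holds G).toFinset.filter fun χ ↦ complexGroupAlgebraRep ρ (charIdempotent χ) ≠ 0).card := by
  classical
  haveI : Fintype (ConjClasses G) := Fintype.ofFinite _
  rw [map_center_groupAlgebraRep_eq_span_classSum, ← finrank_map_center_complexGroupAlgebraRep_eq_card ρ,
    map_center_complexGroupAlgebraRep_eq_span_classSum]
  have hfun : (fun c : ConjClasses G ↦ complexGroupAlgebraRep ρ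
      (∑ g : G, (ConjClasses.carrier c).indicator (1 : G → ℂ) g • MonoidAlgebra.of ℂ G g)) =
      fun c ↦ (((groupAlgebraRep ρ (∑ g : G, (ConjClasses.carrier c).indicator (1 : G → ℚ) g • MonoidAlgebra.of ℚ G g) :
        endAlgRat Φ) : Matrix ι ι ℚ)).map (algebraMap ℚ ℂ) := by
    funext c
    rw [complexGroupAlgebraRep_classSum_eq_map]
    exact congrArg _ (funext fun q ↦ (eq_ratCast (algebraMap ℚ ℂ) q).symm)
  rw [hfun]
  exact (finrank_span_range_map_algebraMap_m (k := ℚ) (K := ℂ) _).symm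

/-- **`dim_ℝ span_ℝ{A_g} ≤ #{χ occurring}`** for the class averages `A_g = Σ_h ρ(hgh⁻¹) ⊗ ℝ = ρ̄(Σ_h hgh⁻¹) ⊗ ℝ` — the
sharp form of g24's `finrank_span_range_sum_conj_le_card_conjClasses` (`≤ k(G)`): their span is `ρ̄(Z(ℚ[G])) ⊗ ℝ`.
[cite: JamesLiebeck2001, §12 Prop. 12.22, held chunk p0072] [cite: Isaacs1976, Thm. 2.13 and Ch. 3 p. 36, p0025, p0040] -/
theorem finrank_span_range_sum_conj_le_card_occurring :
    finrank ℝ (span ℝ (Set.range fun g : G ↦ ∑ h : G,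
        ((ρ (h * g * h⁻¹) : endAlgRat Φ) : Matrix ι ι ℚ).map (Rat.cast : ℚ → ℝ))) ≤
      ((irrChars_finite_holds G).toFinset.filter fun χ ↦ complexGroupAlgebraRep ρ (charIdempotent χ) ≠ 0).card := by
  classical
  -- `A_g = ρ̄(Σ_h hgh⁻¹) ⊗ ℝ`, and the real span of the `ρ̄(Σ_h hgh⁻¹) ⊗ ℝ` has the `ℚ`-dimension of their `ℚ`-span
  have hA : (fun g : G ↦ ∑ h : G, ((ρ (h * g * h⁻¹) : endAlgRat Φ) : Matrix ι ι ℚ).map (Rat.cast : ℚ → ℝ)) =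
      fun g : G ↦ (((groupAlgebraRep ρ (∑ h : G, MonoidAlgebra.of ℚ G (h * g * h⁻¹)) : endAlgRat Φ) : Matrix ι ι ℚ)).map
        (algebraMap ℚ ℝ) := by
    funext g
    rw [← map_coe_groupAlgebraRep_sum_of_conj ρ g]
    exact congrArg _ (funext fun q ↦ (eq_ratCast (algebraMap ℚ ℝ) q).symm)
  rw [hA, finrank_span_range_map_algebraMap_m (k := ℚ) (K := ℝ), ← finrank_map_center_groupAlgebraRep_eq_card ρ]
  refine Submodule.finrank_mono (span_le.mpr ?_)
  rintro _ ⟨g, rfl⟩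
  refine ⟨∑ h : G, MonoidAlgebra.of ℚ G (h * g * h⁻¹), ?_, rfl⟩
  show ∑ h : G, MonoidAlgebra.of ℚ G (h * g * h⁻¹) ∈ Subalgebra.center ℚ (MonoidAlgebra ℚ G)
  rw [← conjugateSum_def]
  exact conjugateSum_mem_center g

end RationalCentre

/-! ### §4 The equality case: `dim_ℚ Z(End_ℚ^G(X)) = #{χ occurring}` -/

section EqualityCase

/-- **THE DIMENSION OF THE CENTRE OF `End_ℚ^G(X)` IN THE EQUALITY CASE: `dim_ℚ Z(End_ℚ^G(X))` is the number of
irreducible characters of `G` occurring in `H₁(X,ℂ)`** (`Z(End_ℚ^G(X)) = ρ̄(Z(ℚ[G]))` by g23's surjectivity of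
`Z(ℚ[G]) → Z(End_ℚ^G(X))`, and `dim_ℚ ρ̄(Z(ℚ[G])) = #{χ occurring}` by §3).  With g25-#4 this number is the sum over the
occurring Galois classes `𝒮(χ)` of `[ℚ(χ):ℚ] = |𝒮(χ)|`, every `ℚ(χ)` a CM field.
[cite: DolgachevZarhin2024, §2.2 Remark 2.17 and (2.18), p0035] [cite: LangeRodriguez2022, §2.9.1 ("`ℚ[G] = Q_1 × ⋯ × Q_r`"), p0043]
[cite: Isaacs1976, Thm. 2.13 and Ch. 3 p. 36, p0025, p0040] -/
theorem finrank_center_endAlgRatG_eq_card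
    (h : endAlgRatG Φ ρ = Subalgebra.centralizer ℚ (Set.range fun g : G ↦ ((ρ g : endAlgRat Φ) : Matrix ι ι ℚ))) :
    finrank ℚ (Subalgebra.center ℚ (endAlgRatG Φ ρ)) =
      ((irrChars_finite_holds G).toFinset.filter fun χ ↦ complexGroupAlgebraRep ρ (charIdempotent χ) ≠ 0).card := by
  classical
  -- the injective linear map `Z(End_ℚ^G(X)) → M_ι(ℚ)` and its range `ρ̄(Z(ℚ[G]))`
  let L : Subalgebra.center ℚ (endAlgRatG Φ ρ) →ₗ[ℚ] Matrix ι ι ℚ :=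
    (endAlgRatG Φ ρ).val.toLinearMap ∘ₗ (Subalgebra.center ℚ (endAlgRatG Φ ρ)).val.toLinearMap
  have hL : ∀ c, L c = ((c : endAlgRatG Φ ρ) : Matrix ι ι ℚ) := fun c ↦ rfl
  have hLinj : Function.Injective L := fun c c' hcc' ↦ Subtype.ext (Subtype.ext (by rwa [hL, hL] at hcc'))
  have hrange : LinearMap.range L = (Subalgebra.toSubmodule (Subalgebra.center ℚ (MonoidAlgebra ℚ G))).map
      ((endAlgRat Φ).val.toLinearMap ∘ₗ (groupAlgebraRep ρ).toLinearMap) := by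
    apply le_antisymm
    · rintro _ ⟨c, rfl⟩
      obtain ⟨z, hz, hzc⟩ := exists_mem_center_groupAlgebraRep_eq_of_mem_center_endAlgRatG ρ h c.2
      exact ⟨z, hz, by rw [hL, ← hzc]; rfl⟩
    · rintro _ ⟨z, hz, rfl⟩
      exact ⟨centerGroupAlgebraToCenter ρ ⟨z, hz⟩, by rw [hL, coe_coe_centerGroupAlgebraToCenter]; rfl⟩
  rw [← LinearMap.finrank_range_of_inj hLinj, hrange, finrank_map_center_groupAlgebraRep_eq_card]

/-- `dim_ℚ Z(End_ℚ^G(X)) ≤ |Irr(G)| = k(G)` in the equality case. [cite: Isaacs1976, Cor. 2.7 and Thm. 2.4 (`|Irr(G)| = k(G)`), p0021, p0020]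
[cite: DolgachevZarhin2024, §2.2 Remark 2.17, p0035] -/
theorem finrank_center_endAlgRatG_le_card_irrChars
    (h : endAlgRatG Φ ρ = Subalgebra.centralizer ℚ (Set.range fun g : G ↦ ((ρ g : endAlgRat Φ) : Matrix ι ι ℚ))) :
    finrank ℚ (Subalgebra.center ℚ (endAlgRatG Φ ρ)) ≤ (irrChars_finite_holds G).toFinset.card := by
  classical
  rw [finrank_center_endAlgRatG_eq_card ρ h]
  exact Finset.card_filter_le _ _

/-- The occurring characters of this file are g24's `occChars` of the rational representation `g ↦ ρ(g)` (FILE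
`…CommutantCMTypesCount`). [cite: LangeRodriguez2022, §2.2 (2.6) and §2.9.1 (2.26), p0029, p0042] -/
theorem filter_ne_zero_eq_occChars :
    ((irrChars_finite_holds G).toFinset.filter fun χ ↦ complexGroupAlgebraRep ρ (charIdempotent χ) ≠ 0) =
      occChars ((((endAlgRat Φ).val : endAlgRat Φ →ₐ[ℚ] Matrix ι ι ℚ).toRingHom.toMonoidHom).comp ρ) := by
  ext χ
  rw [Finset.mem_filter, Set.Finite.mem_toFinset, mem_occChars_comp_iff]
  rfl

/-- **`dim_ℚ Z(End_ℚ^G(X))` is EVEN in the equality case**: the occurring characters come in pairs `χ ≠ χ̄` (no real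
`χ` occurs, g24; `P_{χ̄} = \overline{P_χ}`; g24's conjugation transversals). [cite: DolgachevZarhin2024, §2.2 Remark 2.17 and (2.18), p0035]
[cite: JamesLiebeck2001, §23 Thm. 23.1 (real characters), held chunk p0183] [cite: Shimura1998, §18.1 (`[K:ℚ] = 2n`), chunk p0160] -/
theorem even_finrank_center_endAlgRatG
    (h : endAlgRatG Φ ρ = Subalgebra.centralizer ℚ (Set.range fun g : G ↦ ((ρ g : endAlgRat Φ) : Matrix ι ι ℚ))) :
    Even (finrank ℚ (Subalgebra.center ℚ (endAlgRatG Φ ρ))) := by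
  classical
  rw [finrank_center_endAlgRatG_eq_card ρ h, filter_ne_zero_eq_occChars]
  have hne : ∀ χ ∈ occChars ((((endAlgRat Φ).val : endAlgRat Φ →ₐ[ℚ] Matrix ι ι ℚ).toRingHom.toMonoidHom).comp ρ),
      star χ ≠ χ := fun χ hχ ↦ by
    rw [mem_occChars_comp_iff] at hχ
    exact star_ne_self_of_complexGroupAlgebraRep_charIdempotent_ne_zero ρ h hχ.1 hχ.2
  obtain ⟨S, hS⟩ := (exists_isConjTransversal_iff _).2 hne
  exact even_iff_two_dvd.2 hS.two_dvd_card_occChars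

/-- `dim_ℚ Z(End_ℚ^G(X)) = |Irr(ρ_r)|`, g24's `occChars` form. [cite: DolgachevZarhin2024, §2.2 Remark 2.17 and (2.18), p0035]
[cite: LangeRodriguez2022, §2.9.1, p0043] -/
theorem finrank_center_endAlgRatG_eq_card_occChars
    (h : endAlgRatG Φ ρ = Subalgebra.centralizer ℚ (Set.range fun g : G ↦ ((ρ g : endAlgRat Φ) : Matrix ι ι ℚ))) :
    finrank ℚ (Subalgebra.center ℚ (endAlgRatG Φ ρ)) =
      (occChars ((((endAlgRat Φ).val : endAlgRat Φ →ₐ[ℚ] Matrix ι ι ℚ).toRingHom.toMonoidHom).comp ρ)).card := by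
  rw [finrank_center_endAlgRatG_eq_card ρ h, filter_ne_zero_eq_occChars]

end EqualityCase

/-! ### §5 The Hodge group: `dim_ℝ span_ℝ Hg(X)(ℝ) ≤ #{χ occurring}` -/

section HodgeGroup

/-- **THE HODGE GROUP BOUND, SHARP FORM.**  If `End_ℚ^G(X) = End_{ℚ[G]}(H₁(X,ℚ))`, the real span of the Hodge group
`Hg(X)(ℝ) ⊆ M_ι(ℝ)` has dimension at most the number of irreducible characters of `G` occurring in `H₁(X,ℂ)`:
`Hg(X)(ℝ) ⊆ span_ℝ{A_g}` (g24) `= ρ̄(Z(ℚ[G])) ⊗ ℝ = Z(End_ℚ^G(X)) ⊗ ℝ`, of dimension `#{χ occurring}` (§3–§4) — the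
sharp form of g24's `finrank_span_image_hodgeGroup_le_card_conjClasses` (`≤ k(G)`).  (`Hg(X)` is commutative, lying
in the commutative algebra `Z(End_ℚ^G(X)) ⊗ ℝ`: Lange's Prop. 7.2.6, `X` has complex multiplication.)
[cite: Lange2023AbelianVarietiesComplex, §7.2.2 Prop. 7.2.5 and §7.2.3 Prop. 7.2.6] [cite: DolgachevZarhin2024, §2.2 Remark 2.17 and (2.18), p0035]
[cite: JamesLiebeck2001, §12 Prop. 12.22, held chunk p0072] -/
theorem finrank_span_image_hodgeGroup_le_card_occurring
    (h : endAlgRatG Φ ρ = Subalgebra.centralizer ℚ (Set.range fun g : G ↦ ((ρ g : endAlgRat Φ) : Matrix ι ι ℚ))) :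
    finrank ℝ (span ℝ ((fun M : Matrix.SpecialLinearGroup ι ℝ ↦ M.1) ''
        (hodgeGroup Φ : Set (Matrix.SpecialLinearGroup ι ℝ)))) ≤
      ((irrChars_finite_holds G).toFinset.filter fun χ ↦ complexGroupAlgebraRep ρ (charIdempotent χ) ≠ 0).card :=
  le_trans (Submodule.finrank_mono (span_le.2 (image_hodgeGroup_subset_span_sum_conj ρ h)))
    (finrank_span_range_sum_conj_le_card_occurring ρ)

/-- **`dim_ℝ span_ℝ Hg(X)(ℝ) ≤ dim_ℚ Z(End_ℚ^G(X))`** in the equality case. [cite: Lange2023AbelianVarietiesComplex, §7.2.3 Prop. 7.2.6]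
[cite: DolgachevZarhin2024, §2.2 Remark 2.17, p0035] -/
theorem finrank_span_image_hodgeGroup_le_finrank_center
    (h : endAlgRatG Φ ρ = Subalgebra.centralizer ℚ (Set.range fun g : G ↦ ((ρ g : endAlgRat Φ) : Matrix ι ι ℚ))) :
    finrank ℝ (span ℝ ((fun M : Matrix.SpecialLinearGroup ι ℝ ↦ M.1) ''
        (hodgeGroup Φ : Set (Matrix.SpecialLinearGroup ι ℝ)))) ≤ finrank ℚ (Subalgebra.center ℚ (endAlgRatG Φ ρ)) := by
  rw [finrank_center_endAlgRatG_eq_card ρ h]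
  exact finrank_span_image_hodgeGroup_le_card_occurring ρ h

end HodgeGroup

end ComplexTorus

end Literature.Geometry.Kaehler

end
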